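import Literature.MathematicalPhysics.QuantumFieldTheory.Balaban1983to89.T3UnitScaleTilt
import Literature.MathematicalPhysics.QuantumFieldTheory.Balaban1983to89.T3AlphaInputsACTwoRunLevel
import HarnessLib

/-!
# Crux-idea sketch (ideator 2, gen 11; FINDING N8 «3⁗ pre-registration audit, NEGATION lens») for
# `FluctuationComparisonRegPr[L]` (stmt-QuantumFields-19201 / -19935), line v5j‴ STUB 3⁗ `stub_globalTwoRunSlackFam`.

CONTEXT. OWNER RULINGS g20-№11/№12 (2026-08-27) adopt the SLACK form of the global two-run row as the (C)-content of record:
`GlobalSlack.GlobalSupRateTSlack (dataOfV3 p π) b₀ p₀ a σ C`, `7 ≤ σ`, `0 ≤ C` bound BEFORE `K, n` — per unit-lattice site at height `n ≤ K`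
  `|PintH (K+1) n V − PintH K n V − c K n| ≤ C · #Site(n) · (θ(n)² · L^{−a(K−n)} + θ(n)^σ)`,   `θ(n) = θBal L γ b₀ p₀ n = g_n · p(g_n)`,
`g_n = √(γL^{−n})`, `p(g) = b₀(1 + log g⁻¹)^{p₀}` ([Balaban1985UV3] (7) p.257; tree `B10.pFun`, `T3UnitScaleTilt.θBal`).  The 3⁗ docstring calls the pure-rate
form `GlobalSupRateT` «all-order at fixed height», and `Ideate1Flat.polymerCauchyMinAtTSlack_of_taylor` (sketch g9) says «the typed slack-free row needs in
addition the all-order kernel comparison»; both rest on keeping an order-≥7 REST `R` inside the term function (`TaylorSplit PT E B R`, `RemainderSmall`).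

WHERE PRINT PUTS WHAT ([Balaban1985UV3]; the audit's reading, quoted by locus).  (a) The inductive interaction terms of (41)/(43) p.266 are EXACTLY the
n-linear forms `𝒫_j(Y_j, U_k) = 𝒫_j(g_j, n; B_k(c₁), …, B_k(c_n))`, `2 ≤ n ≤ 6`, in the loop variables of the current configuration, with FLAT kernels —
(33)–(34) p.264 («polynomials in B of at least the second order, and at most the sixth order»; first order absent by semi-simplicity, (32)).  (b) EVERY higher
order — of the cumulant expansions «up to the sixth order in g» ((24) p.262, (55)/(58) p.269–270; remainder `O(g_k⁷p¹⁸(g_k))|B(Λ_{k+1})|`) AND of the background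
expansion (30) («we estimate remainders by the last term in (30)», p.264; (57) p.270 «overall power greater than six») — is booked into the V-INDEPENDENT
two-sided error `Σ_{j<k} O((L^jε)^{3+κ₀})|T₁^{(j)}|` of (41)/(47), its polylogarithms absorbed by the exponent defect `κ₀`.  In the tree that error is the
record's `AlphaDataT3.Rm` (the `Rm`-clauses of `T3LogComparisonSocket.TwoSidedRepAt`: non-negative, V-independent, summable along `n = ⌊K/m⌋` for EACH run
separately) and `PintH` is the finite sum (43).  [King1986]'s additive slack `(L^kε)^σ|T|` of Thm 3.4 (3.9) p.656 is the abelian image of the SAME error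
(his `S_k` is un-truncated; the background-expansion rest (3.47)–(3.49) p.661 of each run is bounded separately) — it corresponds to `Rm`, which the socket
already carries with its own summability clause, not to the `PintH` comparison.

THIS FILE (kernel-checked, 0 sorry; no estimate of [Balaban1985UV3] or [King1986] is proved — rows are hypothesis schemas, theorems are algebra):
  §3 `taylor_core_pure`, `polymerCauchyMinAtT_of_polySplit`, `polymerCauchyMinAtTSlack_of_polySplit`: with print's form (a) — `PolySplit PT E B` (= sketch
     g9's `TaylorSplit PT E B 0`: NO order-≥7 rest inside the term) — flat-kernel Cauchy (K1a, `FlatKernelCauchy`) + `KernelSize` + `CfgSize` + `CfgCauchy` give the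
     PURE per-polymer row `T3AlphaInputsACTwoRunLevel.PolymerCauchyMinAtT` (constant `5(C_s²C + 6C_sC_BC_E)`, shifts 0), hence (`Ideate1Flat.slack_of_pure`)
     sketch g9's per-polymer slack row for EVERY `σ : ℕ` with NO `RemainderSmall` row; sketch g11's producer `Ideate1LocalToGlobal.globalSupRateTSlack_of_polymerSlack`
     (counting; its row is g9's verbatim) then gives 3⁗'s `GlobalSlack.GlobalSupRateTSlack D b₀ p₀ a σ C″` — that last composition is not re-checked here only because
     Cruxes sketches are not importable on the farm snapshot (remote:stale:unbuilt); §0 restates g9's shapes, rows and telescoping algebra VERBATIM for the same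
     reason (attribution: ideator 1, `Ideate1Flat`).  READING: for a print-faithful (α)-record the slack-free row is FINITE-ORDER (orders 2..6) plus the CLASSICAL two-run comparison of the minimisers'
     loop variables (`CfgCauchy`); «all-order» is needed by nobody; `RemainderSmall`/K1c is EMPTY (`R ≡ 0`); the `θ(n)^σ` slack of 3⁗ double-books the error
     already in `Rm` — admissible (the slack row is weaker, `GlobalSlack.slack_of_pure`) and idle.  The slack is NEEDED only by a record that keeps its
     activities UN-EXPANDED in `B` (then the rest is the log-free `θ(n)⁷·L^{−14(K−n−1−j)}` of `RemainderSmall`): a design freedom, not a necessity.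
  §1 `slack7_lt_rem6_eventually` / `slack7_not_dominating_rem6[_levels]` (GUARD-RAIL for any line that would move print's g-truncation remainder (b) from
     `Rm` INTO the `PintH` comparison): print's SIXTH order does not fit `σ ≥ 7` with `C` uniform in `(K, n)` — for every `C` there are `g ∈ (0,1]` (resp.
     served heights `n`, `1 < L`, `0 < γ`) with `C·(g·p(g))⁷ < g⁷p(g)¹⁸`, ratio `p(g)¹¹ → ∞`;
  §2 `rem_highOrder_le_slack7[_levels]`: … and ONE order more does — `g⁸·p(g)^{7+M} ≤ C·(g·p(g))⁷` on `(0,1]` for every `M` (the input `g²p(g)² = O(1)` of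
     Sect. D p.272, tree `B10.gsq_psq_le`, at exponent `M·p₀`; `γ ≤ 1` along the heights): the same polylog-into-power absorption print performs with `κ₀`.
RECOMMENDATIONS (FINDING N8; to the 3⁗ pen ym3-torus-p2, the future ★ym-ust-19935-slack seat, OWNER).  R0 — the (α)-side objects the K1a interface needs
(RULING №12 (ii)) are print's flat kernels `𝒫_i(g_i, n; c₁…c_n)` and loop-variable maps `B_i(U)(c)` of (43) as record FIELDS, with the EXACT structure row
`Pterm = Σ_{n=2}^{6} kernel × monomial` (`TaylorSplit … 0`) and the size rows (44); then 3⁗ ⟸ `FlatKernelCauchy` + `CfgCauchy` + sizes + the geometric clauses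
(§3), in pure form first, with no truncation-order / `σ` bookkeeping on the producer side.  R1 — [King1986]'s rate loss `β ≥ d + ½` ((3.9)) does not
transfer: `d` converts `|T|` to the site count `|T^{(k)}| = (L^kε)^{−d}|T|` (our explicit `#Site`), the excess is Thm 3.5 (i) p.660 `ρ ≥ s/4` from the
scalar legs' window (3.2) p.655 (`|φ_k| ≤ p(L^kε)·λ_k^{−1/4}`); pure SU(2) has `s = 0` and the shrinking window `θ(n)` — the pre-authorised `L^{βn}` weakening
(RULING №11 ADDENDUM) should not be triggered by a faithful port; a port producing one imports scalar-sector bookkeeping.  R2 — §1/§2 as stated.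
WHAT THIS IS NOT: not a refutation or restatement of 3⁗ (nothing registered changes; the slack row stays consumable, p523985); not an estimate on densities;
`FlatKernelCauchy` (flat composite-operator two-grid convergence, orders 2..6) and `CfgCauchy` (constrained-minimiser two-grid convergence) stay UNPRINTED for
non-abelian d = 3 — the crux's residual, unchanged and now isolated from any remainder analysis.
References: T. Bałaban, CMP 102 (1985) 255–275 [Balaban1985UV3] ((7) p.257, (24) p.262, (30)–(34) p.264, (41)–(47) pp.266–267, (55)–(58) pp.269–270,
Sect. D p.272); C. King, CMP 102 (1986) 649–677 [King1986] ((3.1)–(3.2) p.655, Thm 3.4 (3.9) p.656, Thm 3.5 p.660, (3.47)–(3.49) p.661).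
-/

noncomputable section

open Filter Topology
open Literature.MathematicalPhysics.QuantumFieldTheory.Balaban1983to89
open Literature.MathematicalPhysics.QuantumFieldTheory.Balaban1983to89.T3UnitScaleTilt

namespace Summit.QuantumFields.YangMills.Cruxes.FluctuationComparisonRegPr.Ideate2SlackOrder

/-! ## §0 Sketch g9's data shapes, rows and telescoping algebra — VERBATIM (ideator 1, `Ideate1Flat`; restated because Cruxes sketches are not importable) -/

section VerbatimG9

open scoped BigOperators
open Literature.MathematicalPhysics.QuantumFieldTheory.Balaban1983to89.T3ContinuumYM3Torus
open Literature.MathematicalPhysics.QuantumFieldTheory.Balaban1983to89.T3LevelShift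
open Literature.MathematicalPhysics.QuantumFieldTheory.Balaban1983to89.T3AlphaInputsAC
open Literature.MathematicalPhysics.QuantumFieldTheory.Balaban1983to89.T3AlphaPolymerSocket
open Literature.MathematicalPhysics.QuantumFieldTheory.Balaban1983to89.T3AlphaInputsACTwoRun
open Literature.MathematicalPhysics.QuantumFieldTheory.Balaban1983to89.T3AlphaInputsACTwoRunLevel

/-- The bond matching of the two runs (level `i` of run `K` ≃ level `i+1` of run `K+1`; `T3LevelShift.bondShift`). VERBATIM sketch g9. [cite: Balaban1987RG1, (0.1) p.251] -/
def matchBond (F : T3Family) (K i : ℕ) : PBond (F.P K) i ≃ PBond (F.P (K + 1)) (i + 1) :=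
  bondShift (F.sitesPerDir_eq (m := F.m) (K := K) (j := i) (m' := F.m) (K' := K + 1) (j' := i + 1) (by omega))

/-- Flat Taylor kernels (run, birth level, domain, order, bond multi-index ↦ number). VERBATIM sketch g9. [cite: King1986, (3.55) p.662] -/
abbrev Kernel (F : T3Family) : Type :=
  (K i : ℕ) → Set (Site (F.P K) 0) → (p : ℕ) → (Fin p → PBond (F.P K) i) → ℝ

/-- Scalar chart-configuration maps (run, height, level, domain, height-field ↦ bond coordinates). VERBATIM sketch g9. [cite: Balaban1985UV3, (27) p.263] -/
abbrev CfgMapR (F : T3Family) : Type :=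
  (K k i : ℕ) → Set (Site (F.P K) 0) → GaugeField (F.P K) k (Matrix.specialUnitaryGroup (Fin 2) ℂ) → PBond (F.P K) i → ℝ

/-- Polydisc radii of the birth charts. VERBATIM sketch g9. [cite: Balaban1985UV3, (28) p.263] -/
abbrev Radius (F : T3Family) : Type :=
  (K i : ℕ) → Set (Site (F.P K) 0) → PBond (F.P K) i → ℝ

variable {F : T3Family} {γ : ℝ}

/-- **THE PER-POLYMER TWO-CUT-OFF ROW WITH KING'S SLACK** (hypothesis schema, never asserted). VERBATIM sketch g9 §1 (= sketch g11 §1).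
[cite: King1986, Thm. 3.4 (3.9) p.656] -/
def PolymerCauchyMinAtTSlack (D : AlphaDataT3 F γ) (PT : TermFn F) (b₀ p₀ κ₁ a : ℝ) (σ : ℕ) (C : ℝ) : Prop :=
  ∃ c : (K n j : ℕ) → Set (Site (F.P K) 0) → ℝ,
    ∀ (K n : ℕ) (h : n ≤ K), ∀ j : ℕ, j < K - n →
      ∀ V : GaugeField (F.P n) 0 (Matrix.specialUnitaryGroup (Fin 2) ℂ), PlaqSmall (θBal F.L γ b₀ p₀ n) V →
        ∀ Y ∈ D.Loc K (K - n) (D.triv K (K - n)) (1 + j),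
          |PT (K + 1) (K + 1 - n) (1 + (j + 1)) (refineSet F K Y)
              (fieldShift (F.sitesPerDir_eq (m := F.m) (K := K + 1) (j := K + 1 - n) (m' := F.m) (K' := n) (j' := 0) (by omega)) V) -
            PT K (K - n) (1 + j) Y
              (fieldShift (F.sitesPerDir_eq (m := F.m) (K := K) (j := K - n) (m' := F.m) (K' := n) (j' := 0) (by omega)) V) -
            c K n j Y| ≤
          C * Real.exp (-κ₁ * D.treeLen K (1 + j) Y) * (((F.L : ℝ) ^ (K - n - 1 - j))⁻¹) ^ 4 *
            (θBal F.L γ b₀ p₀ n ^ 2 * (((F.L : ℝ) ^ (1 + j))⁻¹) ^ a + θBal F.L γ b₀ p₀ n ^ σ)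

/-- The slack row is implied by the pure row `T3AlphaInputsACTwoRunLevel.PolymerCauchyMinAtT` (a weakening). VERBATIM sketch g9. [folklore] -/
theorem slack_of_pure {D : AlphaDataT3 F γ} {PT : TermFn F} {b₀ p₀ κ₁ a C : ℝ} (σ : ℕ) (hC : 0 ≤ C)
    (hθ : ∀ n, 0 ≤ θBal F.L γ b₀ p₀ n) (h : PolymerCauchyMinAtT D PT b₀ p₀ κ₁ a C) :
    PolymerCauchyMinAtTSlack D PT b₀ p₀ κ₁ a σ C := by
  obtain ⟨c, hc⟩ := h
  refine ⟨c, ?_⟩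
  intro K n hn j hj V hV Y hY
  refine (hc K n hn j hj V hV Y hY).trans ?_
  have hP : 0 ≤ C * Real.exp (-κ₁ * D.treeLen K (1 + j) Y) * (((F.L : ℝ) ^ (K - n - 1 - j))⁻¹) ^ 4 :=
    mul_nonneg (mul_nonneg hC (Real.exp_pos _).le) (by positivity)
  have hσ : 0 ≤ θBal F.L γ b₀ p₀ n ^ σ := pow_nonneg (hθ n) σ
  have hmain : C * Real.exp (-κ₁ * D.treeLen K (1 + j) Y) * θBal F.L γ b₀ p₀ n ^ 2 *
        (((F.L : ℝ) ^ (K - n - 1 - j))⁻¹) ^ 4 * (((F.L : ℝ) ^ (1 + j))⁻¹) ^ a =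
      C * Real.exp (-κ₁ * D.treeLen K (1 + j) Y) * (((F.L : ℝ) ^ (K - n - 1 - j))⁻¹) ^ 4 *
        (θBal F.L γ b₀ p₀ n ^ 2 * (((F.L : ℝ) ^ (1 + j))⁻¹) ^ a) := by ring
  rw [hmain, mul_add]
  exact le_add_of_nonneg_right (mul_nonneg hP hσ)

/-- **K1a — FLAT-KERNEL CAUCHY ROW** (hypothesis schema, never asserted). VERBATIM sketch g9. [cite: King1986, Prop. 3.6 (3.56) p.662, Prop. 3.9 (3.74) p.665] -/
def FlatKernelCauchy (D : AlphaDataT3 F γ) (E : Kernel F) (r : Radius F) (κ a C : ℝ) : Prop :=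
  ∀ (K k i : ℕ) (Y : Set (Site (F.P K) 0)), Y ∈ D.Loc K k (D.triv K k) i →
    ∀ p ∈ Finset.Icc 2 6,
      ∑ c : Fin p → PBond (F.P K) i,
          |E (K + 1) (i + 1) (refineSet F K Y) p (fun l => matchBond F K i (c l)) - E K i Y p c| * ∏ l, r K i Y (c l) ≤
        C * Real.exp (-κ * D.treeLen K i Y) * (((F.L : ℝ) ^ i)⁻¹) ^ a

/-- **KERNEL SIZE ROW** (hypothesis schema, never asserted). VERBATIM sketch g9. [cite: Balaban1985UV3, Prop. 3 (34) p.264] -/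
def KernelSize (D : AlphaDataT3 F γ) (E : Kernel F) (r : Radius F) (κ C_E : ℝ) : Prop :=
  ∀ (K k i : ℕ) (Y : Set (Site (F.P K) 0)), Y ∈ D.Loc K k (D.triv K k) i →
    ∀ p ∈ Finset.Icc 2 6, ∑ c : Fin p → PBond (F.P K) i, |E K i Y p c| * ∏ l, r K i Y (c l) ≤ C_E * Real.exp (-κ * D.treeLen K i Y)

/-- **CONFIGURATION SIZE ROW** (hypothesis schema, never asserted). VERBATIM sketch g9. [cite: Balaban1985UV3, (28) p.263, (44) p.267] -/
def CfgSize (D : AlphaDataT3 F γ) (B : CfgMapR F) (r : Radius F) (b₀ p₀ C_s : ℝ) : Prop :=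
  ∀ (K n : ℕ) (h : n ≤ K), ∀ j : ℕ, j < K - n →
    ∀ V : GaugeField (F.P n) 0 (Matrix.specialUnitaryGroup (Fin 2) ℂ), PlaqSmall (θBal F.L γ b₀ p₀ n) V →
      ∀ Y ∈ D.Loc K (K - n) (D.triv K (K - n)) (1 + j), ∀ c : PBond (F.P K) (1 + j),
        |B K (K - n) (1 + j) Y
            (fieldShift (F.sitesPerDir_eq (m := F.m) (K := K) (j := K - n) (m' := F.m) (K' := n) (j' := 0) (by omega)) V) c| ≤
          C_s * θBal F.L γ b₀ p₀ n * (((F.L : ℝ) ^ (K - n - 1 - j))⁻¹) ^ 2 * r K (1 + j) Y c ∧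
        |B (K + 1) (K + 1 - n) (1 + (j + 1)) (refineSet F K Y)
            (fieldShift (F.sitesPerDir_eq (m := F.m) (K := K + 1) (j := K + 1 - n) (m' := F.m) (K' := n) (j' := 0) (by omega)) V)
            (matchBond F K (1 + j) c)| ≤
          C_s * θBal F.L γ b₀ p₀ n * (((F.L : ℝ) ^ (K - n - 1 - j))⁻¹) ^ 2 * r K (1 + j) Y c

/-- **CONFIGURATION CAUCHY ROW** (hypothesis schema, never asserted; the CLASSICAL two-run comparison of the minimisers' loop variables). VERBATIM sketch g9.
[cite: King1986, Prop. 3.9 (3.71) p.665] -/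
def CfgCauchy (D : AlphaDataT3 F γ) (B : CfgMapR F) (r : Radius F) (b₀ p₀ a C_B : ℝ) : Prop :=
  ∀ (K n : ℕ) (h : n ≤ K), ∀ j : ℕ, j < K - n →
    ∀ V : GaugeField (F.P n) 0 (Matrix.specialUnitaryGroup (Fin 2) ℂ), PlaqSmall (θBal F.L γ b₀ p₀ n) V →
      ∀ Y ∈ D.Loc K (K - n) (D.triv K (K - n)) (1 + j), ∀ c : PBond (F.P K) (1 + j),
        |B (K + 1) (K + 1 - n) (1 + (j + 1)) (refineSet F K Y)
              (fieldShift (F.sitesPerDir_eq (m := F.m) (K := K + 1) (j := K + 1 - n) (m' := F.m) (K' := n) (j' := 0) (by omega)) V)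
              (matchBond F K (1 + j) c) -
            B K (K - n) (1 + j) Y
              (fieldShift (F.sitesPerDir_eq (m := F.m) (K := K) (j := K - n) (m' := F.m) (K' := n) (j' := 0) (by omega)) V) c| ≤
          C_B * θBal F.L γ b₀ p₀ n * (((F.L : ℝ) ^ (K - n - 1 - j))⁻¹) ^ 2 * (((F.L : ℝ) ^ (1 + j))⁻¹) ^ a * r K (1 + j) Y c

/-- Reindex a sum over bond multi-indices of run `K+1` through the bond matching. VERBATIM sketch g9. [folklore] -/
theorem sum_reindex {ι ι' : Type*} [Fintype ι] [Fintype ι'] (m : ι ≃ ι') (p : ℕ) (G : (Fin p → ι') → ℝ) :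
    ∑ c' : Fin p → ι', G c' = ∑ c : Fin p → ι, G (fun l => m (c l)) :=
  (Fintype.sum_equiv (Equiv.arrowCongr (Equiv.refl (Fin p)) m) (fun c => G (fun l => m (c l))) G (fun _ => rfl)).symm

/-- A monomial on the polydisc shrunk by `s`. VERBATIM sketch g9. [folklore] -/
theorem abs_prod_le {p : ℕ} {x r : Fin p → ℝ} {s : ℝ} (hx : ∀ l, |x l| ≤ s * r l) :
    |∏ l, x l| ≤ s ^ p * ∏ l, r l := by
  rw [Finset.abs_prod]
  calc ∏ l, |x l| ≤ ∏ l, (s * r l) := Finset.prod_le_prod (fun l _ => abs_nonneg _) (fun l _ => hx l)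
    _ = s ^ p * ∏ l, r l := by rw [Finset.prod_mul_distrib, Finset.prod_const, Finset.card_univ, Fintype.card_fin]

/-- Multilinear telescoping. VERBATIM sketch g9. [folklore] -/
theorem abs_prod_sub_prod_le {s t : ℝ} (hs : 0 ≤ s) (ht : 0 ≤ t) :
    ∀ (p : ℕ) (x y r : Fin p → ℝ), (∀ l, 0 ≤ r l) → (∀ l, |x l| ≤ s * r l) → (∀ l, |y l| ≤ s * r l) →
      (∀ l, |x l - y l| ≤ t * r l) → |∏ l, x l - ∏ l, y l| ≤ p * s ^ (p - 1) * t * ∏ l, r l := by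
  intro p
  induction p with
  | zero => intro x y r _ _ _ _; simp
  | succ p ih =>
    intro x y r hr hx hy hxy
    simp only [Fin.prod_univ_succ]
    have hX : |∏ l : Fin p, x l.succ| ≤ s ^ p * ∏ l : Fin p, r l.succ := abs_prod_le (fun l => hx _)
    have hXY : |∏ l : Fin p, x l.succ - ∏ l : Fin p, y l.succ| ≤ p * s ^ (p - 1) * t * ∏ l : Fin p, r l.succ :=
      ih (fun l => x l.succ) (fun l => y l.succ) (fun l => r l.succ) (fun l => hr _) (fun l => hx _) (fun l => hy _) (fun l => hxy _)
    have hRr : 0 ≤ ∏ l : Fin p, r l.succ := Finset.prod_nonneg fun l _ => hr _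
    have hsp : s * ((p : ℝ) * s ^ (p - 1)) ≤ (p : ℝ) * s ^ p := by
      rcases Nat.eq_zero_or_pos p with rfl | hp
      · simp
      · obtain ⟨q, rfl⟩ : ∃ q, p = q + 1 := ⟨p - 1, by omega⟩
        simp only [Nat.add_sub_cancel, pow_succ]
        nlinarith [pow_nonneg hs q]
    have key : x 0 * ∏ l : Fin p, x l.succ - y 0 * ∏ l : Fin p, y l.succ =
        (x 0 - y 0) * ∏ l : Fin p, x l.succ + y 0 * (∏ l : Fin p, x l.succ - ∏ l : Fin p, y l.succ) := by ring
    rw [key]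
    have h0 : 0 ≤ t * r 0 := mul_nonneg ht (hr 0)
    have h1 : 0 ≤ s * r 0 := mul_nonneg hs (hr 0)
    have hTRR : 0 ≤ t * r 0 * ∏ l : Fin p, r l.succ := mul_nonneg h0 hRr
    calc |(x 0 - y 0) * ∏ l : Fin p, x l.succ + y 0 * (∏ l : Fin p, x l.succ - ∏ l : Fin p, y l.succ)|
        ≤ |x 0 - y 0| * |∏ l : Fin p, x l.succ| + |y 0| * |∏ l : Fin p, x l.succ - ∏ l : Fin p, y l.succ| := by
          rw [← abs_mul, ← abs_mul]; exact abs_add_le _ _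
      _ ≤ (t * r 0) * (s ^ p * ∏ l : Fin p, r l.succ) + (s * r 0) * (p * s ^ (p - 1) * t * ∏ l : Fin p, r l.succ) :=
          add_le_add (mul_le_mul (hxy 0) hX (abs_nonneg _) h0) (mul_le_mul (hy 0) hXY (abs_nonneg _) h1)
      _ = t * r 0 * (∏ l : Fin p, r l.succ) * s ^ p + (s * ((p : ℝ) * s ^ (p - 1))) * (t * r 0 * ∏ l : Fin p, r l.succ) := by ring
      _ ≤ t * r 0 * (∏ l : Fin p, r l.succ) * s ^ p + ((p : ℝ) * s ^ p) * (t * r 0 * ∏ l : Fin p, r l.succ) :=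
          add_le_add le_rfl (mul_le_mul_of_nonneg_right hsp hTRR)
      _ = ((p + 1 : ℕ) : ℝ) * s ^ (p + 1 - 1) * t * (r 0 * ∏ l : Fin p, r l.succ) := by
          simp only [Nat.add_sub_cancel, Nat.cast_add, Nat.cast_one]; ring

/-- **ONE TAYLOR ORDER** on the `s`-shrunk polydisc (`s ≤ 1`, `2 ≤ p ≤ 6`). VERBATIM sketch g9. [cite: King1986, (3.57) p.662] -/
theorem per_order {ι ι' : Type*} [Fintype ι] [Fintype ι'] (m : ι ≃ ι') {p : ℕ} (hp2 : 2 ≤ p) (hp6 : p ≤ 6)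
    (E : (Fin p → ι) → ℝ) (E' : (Fin p → ι') → ℝ) (B₀ : ι → ℝ) (B₁ : ι' → ℝ) (r : ι → ℝ)
    {s t e ρ C C_E : ℝ} (hs0 : 0 ≤ s) (hs1 : s ≤ 1) (ht : 0 ≤ t) (hr : ∀ c, 0 ≤ r c)
    (hB₀ : ∀ c, |B₀ c| ≤ s * r c) (hB₁ : ∀ c, |B₁ (m c)| ≤ s * r c) (hΔ : ∀ c, |B₁ (m c) - B₀ c| ≤ t * r c)
    (hK : ∑ c : Fin p → ι, |E' (fun l => m (c l)) - E c| * ∏ l, r (c l) ≤ C * e * ρ)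
    (hE : ∑ c : Fin p → ι, |E c| * ∏ l, r (c l) ≤ C_E * e) :
    |∑ c' : Fin p → ι', E' c' * ∏ l, B₁ (c' l) - ∑ c : Fin p → ι, E c * ∏ l, B₀ (c l)| ≤
      s ^ 2 * (C * e * ρ) + 6 * s * t * (C_E * e) := by
  rw [sum_reindex m p, ← Finset.sum_sub_distrib]
  refine (Finset.abs_sum_le_sum_abs _ _).trans ?_
  have hpt : ∀ c : Fin p → ι,
      |E' (fun l => m (c l)) * ∏ l, B₁ (m (c l)) - E c * ∏ l, B₀ (c l)| ≤
        s ^ p * (|E' (fun l => m (c l)) - E c| * ∏ l, r (c l)) + (p * s ^ (p - 1) * t) * (|E c| * ∏ l, r (c l)) := by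
    intro c
    have hP1 : |∏ l, B₁ (m (c l))| ≤ s ^ p * ∏ l, r (c l) := abs_prod_le (fun l => hB₁ _)
    have hPd : |∏ l, B₁ (m (c l)) - ∏ l, B₀ (c l)| ≤ p * s ^ (p - 1) * t * ∏ l, r (c l) :=
      abs_prod_sub_prod_le hs0 ht p (fun l => B₁ (m (c l))) (fun l => B₀ (c l)) (fun l => r (c l))
        (fun l => hr _) (fun l => hB₁ _) (fun l => hB₀ _) (fun l => hΔ _)
    have key : E' (fun l => m (c l)) * ∏ l, B₁ (m (c l)) - E c * ∏ l, B₀ (c l) =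
        (E' (fun l => m (c l)) - E c) * ∏ l, B₁ (m (c l)) + E c * (∏ l, B₁ (m (c l)) - ∏ l, B₀ (c l)) := by ring
    rw [key]
    calc |(E' (fun l => m (c l)) - E c) * ∏ l, B₁ (m (c l)) + E c * (∏ l, B₁ (m (c l)) - ∏ l, B₀ (c l))|
        ≤ |E' (fun l => m (c l)) - E c| * |∏ l, B₁ (m (c l))| + |E c| * |∏ l, B₁ (m (c l)) - ∏ l, B₀ (c l)| := by
          rw [← abs_mul, ← abs_mul]; exact abs_add_le _ _
      _ ≤ |E' (fun l => m (c l)) - E c| * (s ^ p * ∏ l, r (c l)) + |E c| * (p * s ^ (p - 1) * t * ∏ l, r (c l)) :=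
          add_le_add (mul_le_mul_of_nonneg_left hP1 (abs_nonneg _)) (mul_le_mul_of_nonneg_left hPd (abs_nonneg _))
      _ = _ := by ring
  refine (Finset.sum_le_sum fun c _ => hpt c).trans ?_
  rw [Finset.sum_add_distrib, ← Finset.mul_sum, ← Finset.mul_sum]
  have h1 : s ^ p ≤ s ^ 2 := pow_le_pow_of_le_one hs0 hs1 hp2
  have h2 : (p : ℝ) * s ^ (p - 1) ≤ 6 * s := by
    have h' : s ^ (p - 1) ≤ s ^ 1 := pow_le_pow_of_le_one hs0 hs1 (by omega)
    rw [pow_one] at h'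
    have hp6' : (p : ℝ) ≤ 6 := by exact_mod_cast hp6
    exact mul_le_mul hp6' h' (pow_nonneg hs0 _) (by norm_num)
  have hKnn : 0 ≤ C * e * ρ :=
    le_trans (Finset.sum_nonneg fun c _ => mul_nonneg (abs_nonneg _) (Finset.prod_nonneg fun l _ => hr _)) hK
  have hEnn : 0 ≤ C_E * e :=
    le_trans (Finset.sum_nonneg fun c _ => mul_nonneg (abs_nonneg _) (Finset.prod_nonneg fun l _ => hr _)) hE
  have hsp0 : 0 ≤ s ^ p := pow_nonneg hs0 _
  have hpt0 : 0 ≤ (p : ℝ) * s ^ (p - 1) * t := mul_nonneg (mul_nonneg (Nat.cast_nonneg _) (pow_nonneg hs0 _)) ht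
  calc s ^ p * ∑ c : Fin p → ι, |E' (fun l => m (c l)) - E c| * ∏ l, r (c l) +
        (p * s ^ (p - 1) * t) * ∑ c : Fin p → ι, |E c| * ∏ l, r (c l)
      ≤ s ^ p * (C * e * ρ) + (p * s ^ (p - 1) * t) * (C_E * e) :=
        add_le_add (mul_le_mul_of_nonneg_left hK hsp0) (mul_le_mul_of_nonneg_left hE hpt0)
    _ ≤ s ^ 2 * (C * e * ρ) + (6 * s * t) * (C_E * e) := by
        have h2' : (p : ℝ) * s ^ (p - 1) * t ≤ 6 * s * t := mul_le_mul_of_nonneg_right h2 ht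
        exact add_le_add (mul_le_mul_of_nonneg_right h1 hKnn) (mul_le_mul_of_nonneg_right h2' hEnn)
    _ = _ := by ring

end VerbatimG9

/-! ## §1 Print's sixth-order remainder envelope is not dominated by the typed slack `C·θ⁷` -/

/-- **NEGATIVE HALF (filter form).** For `b₀ > 0`, `p₀ > 0` and every constant `C`: eventually as `g → 0⁺`, `g ≤ 1` and
`C·(g·p(g))⁷ < g⁷·p(g)¹⁸` — the ratio of print's sixth-order remainder envelope to the typed slack is `p(g)¹¹ = b₀¹¹(1 + log g⁻¹)^{11p₀} → ∞`.
[cite: Balaban1985UV3, (24) p.262] -/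
theorem slack7_lt_rem6_eventually (b₀ p₀ : ℝ) (hb : 0 < b₀) (hp : 0 < p₀) (C : ℝ) :
    ∀ᶠ g in 𝓝[>] (0 : ℝ), g ≤ 1 ∧ C * (g * B10.pFun b₀ p₀ g) ^ 7 < g ^ 7 * B10.pFun b₀ p₀ g ^ 18 := by
  have h1 : Tendsto (fun g : ℝ => Real.log g⁻¹) (𝓝[>] 0) atTop :=
    Real.tendsto_log_atTop.comp tendsto_inv_nhdsGT_zero
  have h2 : Tendsto (fun g : ℝ => 1 + Real.log g⁻¹) (𝓝[>] 0) atTop := tendsto_atTop_add_const_left _ 1 h1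
  have h3 : Tendsto (fun g : ℝ => (1 + Real.log g⁻¹) ^ ((11 : ℝ) * p₀)) (𝓝[>] 0) atTop :=
    (tendsto_rpow_atTop (by positivity)).comp h2
  have h4 : Tendsto (fun g : ℝ => b₀ ^ 11 * (1 + Real.log g⁻¹) ^ ((11 : ℝ) * p₀)) (𝓝[>] 0) atTop :=
    h3.const_mul_atTop (by positivity)
  have hC := h4.eventually_gt_atTop C
  have hle : ∀ᶠ g in 𝓝[>] (0 : ℝ), g ≤ 1 := (eventually_le_nhds zero_lt_one).filter_mono nhdsWithin_le_nhds
  have hpos : ∀ᶠ g in 𝓝[>] (0 : ℝ), g ∈ Set.Ioi 0 := eventually_mem_nhdsWithin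
  filter_upwards [hC, hle, hpos] with g hgC hg1 hg0
  have hg0 : 0 < g := hg0
  refine ⟨hg1, ?_⟩
  have hl := B10.log_inv_nonneg_of_le_one hg0 hg1
  have hu0 : 0 ≤ 1 + Real.log g⁻¹ := by linarith
  have hu1 : 0 < 1 + Real.log g⁻¹ := by linarith
  have hp11 : B10.pFun b₀ p₀ g ^ 11 = b₀ ^ 11 * (1 + Real.log g⁻¹) ^ ((11 : ℝ) * p₀) := by
    unfold B10.pFun
    rw [mul_pow, ← Real.rpow_natCast ((1 + Real.log g⁻¹) ^ p₀) 11, ← Real.rpow_mul hu0, mul_comm p₀]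
    norm_num
  have hppos : 0 < B10.pFun b₀ p₀ g := by
    unfold B10.pFun; exact mul_pos hb (Real.rpow_pos_of_pos hu1 _)
  have hq : 0 < g ^ 7 * B10.pFun b₀ p₀ g ^ 7 := mul_pos (pow_pos hg0 7) (pow_pos hppos 7)
  calc C * (g * B10.pFun b₀ p₀ g) ^ 7 = C * (g ^ 7 * B10.pFun b₀ p₀ g ^ 7) := by rw [mul_pow]
    _ < B10.pFun b₀ p₀ g ^ 11 * (g ^ 7 * B10.pFun b₀ p₀ g ^ 7) := by
        rw [hp11]; exact mul_lt_mul_of_pos_right hgC hq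
    _ = g ^ 7 * B10.pFun b₀ p₀ g ^ 18 := by ring

/-- **NEGATIVE HALF (witness form).** For every `C` there is a coupling `g ∈ (0,1]` with `C·(g·p(g))⁷ < g⁷·p(g)¹⁸`: no constant
makes the typed slack `C·θ⁷` (θ = g·p(g)) dominate print's sixth-order remainder envelope uniformly in the coupling. [cite: Balaban1985UV3, (24) p.262] -/
theorem slack7_not_dominating_rem6 (b₀ p₀ : ℝ) (hb : 0 < b₀) (hp : 0 < p₀) (C : ℝ) :
    ∃ g : ℝ, 0 < g ∧ g ≤ 1 ∧ C * (g * B10.pFun b₀ p₀ g) ^ 7 < g ^ 7 * B10.pFun b₀ p₀ g ^ 18 := by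
  obtain ⟨g, hg0, hg1, h⟩ :=
    ((eventually_mem_nhdsWithin (a := (0 : ℝ)) (s := Set.Ioi 0)).and
      (slack7_lt_rem6_eventually b₀ p₀ hb hp C)).exists
  exact ⟨g, hg0, hg1, h⟩

/-- **NEGATIVE HALF ALONG THE SERVED HEIGHTS.** For `1 < L`, `0 < γ` and every `C` there is a height `n` at which
`C·θBal L γ b₀ p₀ n ^ 7 < g_n⁷·p(g_n)¹⁸` (`g_n = √(γL^{−n}) → 0⁺`): a constant `C` bound before `(K, n)`, as in `GlobalSupRateTSlack`, cannot absorb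
the sixth-order remainder envelope at all heights. [cite: Balaban1985UV3, (55) p.269] -/
theorem slack7_not_dominating_rem6_levels (L : ℕ) (hL : 1 < L) (γ b₀ p₀ : ℝ) (hγ : 0 < γ) (hb : 0 < b₀) (hp : 0 < p₀)
    (C : ℝ) : ∃ n : ℕ, C * θBal L γ b₀ p₀ n ^ 7 <
      Real.sqrt (γ * ((L : ℝ)⁻¹) ^ n) ^ 7 * B10.pFun b₀ p₀ (Real.sqrt (γ * ((L : ℝ)⁻¹) ^ n)) ^ 18 := by
  have hL' : (1 : ℝ) < L := by exact_mod_cast hL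
  have hL0 : (0 : ℝ) < L := zero_lt_one.trans hL'
  have h0 : Tendsto (fun n : ℕ => γ * ((L : ℝ)⁻¹) ^ n) atTop (𝓝 0) := by
    simpa using (tendsto_pow_atTop_nhds_zero_of_lt_one (inv_nonneg.mpr hL0.le)
      (inv_lt_one_of_one_lt₀ hL')).const_mul γ
  have h1 : Tendsto (fun n : ℕ => Real.sqrt (γ * ((L : ℝ)⁻¹) ^ n)) atTop (𝓝 0) := by
    have := (Real.continuous_sqrt.tendsto 0).comp h0
    rw [Real.sqrt_zero] at this
    exact this
  have hpos : ∀ n : ℕ, 0 < Real.sqrt (γ * ((L : ℝ)⁻¹) ^ n) := fun n => Real.sqrt_pos.mpr (by positivity)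
  have h2 : Tendsto (fun n : ℕ => Real.sqrt (γ * ((L : ℝ)⁻¹) ^ n)) atTop (𝓝[>] 0) :=
    tendsto_nhdsWithin_iff.mpr ⟨h1, Eventually.of_forall fun n => hpos n⟩
  obtain ⟨n, -, hn⟩ := (h2.eventually (slack7_lt_rem6_eventually b₀ p₀ hb hp C)).exists
  exact ⟨n, hn⟩

/-! ## §2 Truncating one order higher lands inside the slack (the repair inside the method) -/

/-- **POSITIVE HALF.** For `b₀ > 0`, `p₀ > 0` and every extra leg count `M`: there is `C ≥ 0` with `g⁸·p(g)^{7+M} ≤ C·(g·p(g))⁷` on `(0,1]`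
— i.e. `g·p(g)^M = O(1)`, the superrenormalisability input `g²p(g)² = O(1)` of [Balaban1985UV3] Sect. D p.272 (tree `B10.gsq_psq_le`) at exponent `M·p₀`.
So a SEVENTH-order truncation remainder `O(g⁸p^{7+M})` per site IS dominated by the typed slack with `σ = 7`. [cite: Balaban1985UV3, Sect. D p.272] -/
theorem rem_highOrder_le_slack7 (b₀ p₀ : ℝ) (hb : 0 < b₀) (hp : 0 < p₀) (M : ℕ) :
    ∃ C : ℝ, 0 ≤ C ∧ ∀ g : ℝ, 0 < g → g ≤ 1 →
      g ^ 8 * B10.pFun b₀ p₀ g ^ (7 + M) ≤ C * (g * B10.pFun b₀ p₀ g) ^ 7 := by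
  rcases Nat.eq_zero_or_pos M with hM | hM
  · subst hM
    refine ⟨1, zero_le_one, fun g hg hg1 => ?_⟩
    have hp0 : 0 ≤ B10.pFun b₀ p₀ g := B10.pFun_nonneg _ _ _ hb.le hg hg1
    have hq : 0 ≤ g ^ 7 * B10.pFun b₀ p₀ g ^ 7 := mul_nonneg (pow_nonneg hg.le 7) (pow_nonneg hp0 7)
    calc g ^ 8 * B10.pFun b₀ p₀ g ^ (7 + 0) = g * (g ^ 7 * B10.pFun b₀ p₀ g ^ 7) := by ring
      _ ≤ 1 * (g ^ 7 * B10.pFun b₀ p₀ g ^ 7) := mul_le_mul_of_nonneg_right hg1 hq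
      _ = 1 * (g * B10.pFun b₀ p₀ g) ^ 7 := by rw [mul_pow]
  · set D : ℝ := (b₀ ^ M) ^ 2 * ((((M : ℝ) * p₀) ^ (2 * ((M : ℝ) * p₀))) * Real.exp (2 - 2 * ((M : ℝ) * p₀)))
      with hD
    refine ⟨Real.sqrt D, Real.sqrt_nonneg _, fun g hg hg1 => ?_⟩
    have hl := B10.log_inv_nonneg_of_le_one hg hg1
    have hu0 : 0 ≤ 1 + Real.log g⁻¹ := by linarith
    have hp0 : 0 ≤ B10.pFun b₀ p₀ g := B10.pFun_nonneg _ _ _ hb.le hg hg1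
    have hpM : B10.pFun b₀ p₀ g ^ M = B10.pFun (b₀ ^ M) ((M : ℝ) * p₀) g := by
      unfold B10.pFun
      rw [mul_pow, ← Real.rpow_natCast ((1 + Real.log g⁻¹) ^ p₀) M, ← Real.rpow_mul hu0, mul_comm p₀]
    have hMp : 0 < (M : ℝ) * p₀ := mul_pos (by exact_mod_cast hM) hp
    have hsq : (g * B10.pFun b₀ p₀ g ^ M) ^ 2 ≤ D := by
      rw [mul_pow, hpM, hD]; exact B10.gsq_psq_le _ _ g hMp hg hg1
    have h0 : 0 ≤ g * B10.pFun b₀ p₀ g ^ M := mul_nonneg hg.le (pow_nonneg hp0 M)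
    have hgp : g * B10.pFun b₀ p₀ g ^ M ≤ Real.sqrt D :=
      calc g * B10.pFun b₀ p₀ g ^ M = Real.sqrt ((g * B10.pFun b₀ p₀ g ^ M) ^ 2) := (Real.sqrt_sq h0).symm
        _ ≤ Real.sqrt D := Real.sqrt_le_sqrt hsq
    have hq : 0 ≤ g ^ 7 * B10.pFun b₀ p₀ g ^ 7 := mul_nonneg (pow_nonneg hg.le 7) (pow_nonneg hp0 7)
    calc g ^ 8 * B10.pFun b₀ p₀ g ^ (7 + M)
        = (g * B10.pFun b₀ p₀ g ^ M) * (g ^ 7 * B10.pFun b₀ p₀ g ^ 7) := by ring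
      _ ≤ Real.sqrt D * (g ^ 7 * B10.pFun b₀ p₀ g ^ 7) := mul_le_mul_of_nonneg_right hgp hq
      _ = Real.sqrt D * (g * B10.pFun b₀ p₀ g) ^ 7 := by rw [mul_pow]

/-- **POSITIVE HALF ALONG THE SERVED HEIGHTS.** For `1 ≤ L`, `0 < γ ≤ 1`: one constant `C ≥ 0`, bound before the height, with
`g_n⁸·p(g_n)^{7+M} ≤ C·θBal L γ b₀ p₀ n ^ 7` at EVERY height `n` (`g_n = √(γL^{−n}) ∈ (0,1]`) — the seventh-order remainder envelope sits inside the
slack of `GlobalSupRateTSlack … 7 C`. [cite: Balaban1985UV3, Sect. D p.272] -/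
theorem rem_highOrder_le_slack7_levels (L : ℕ) (hL : 1 ≤ L) (γ b₀ p₀ : ℝ) (hγ : 0 < γ) (hγ1 : γ ≤ 1) (hb : 0 < b₀)
    (hp : 0 < p₀) (M : ℕ) : ∃ C : ℝ, 0 ≤ C ∧ ∀ n : ℕ,
      Real.sqrt (γ * ((L : ℝ)⁻¹) ^ n) ^ 8 * B10.pFun b₀ p₀ (Real.sqrt (γ * ((L : ℝ)⁻¹) ^ n)) ^ (7 + M) ≤
        C * θBal L γ b₀ p₀ n ^ 7 := by
  obtain ⟨C, hC0, hC⟩ := rem_highOrder_le_slack7 b₀ p₀ hb hp M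
  have hL1 : (1 : ℝ) ≤ L := by exact_mod_cast hL
  have hL0 : (0 : ℝ) < L := zero_lt_one.trans_le hL1
  refine ⟨C, hC0, fun n => ?_⟩
  have hx0 : 0 ≤ ((L : ℝ)⁻¹) ^ n := pow_nonneg (inv_nonneg.mpr hL0.le) n
  have hx1 : ((L : ℝ)⁻¹) ^ n ≤ 1 := pow_le_one₀ (inv_nonneg.mpr hL0.le) ((inv_le_one₀ hL0).mpr hL1)
  have hg0 : 0 < Real.sqrt (γ * ((L : ℝ)⁻¹) ^ n) := Real.sqrt_pos.mpr (by positivity)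
  have hg1 : Real.sqrt (γ * ((L : ℝ)⁻¹) ^ n) ≤ 1 :=
    (Real.sqrt_le_sqrt (mul_le_one₀ hγ1 hx0 hx1)).trans_eq Real.sqrt_one
  exact hC _ hg0 hg1


/-! ## §3 Print's polynomial activities ((43) p.266: degree 2..6, flat kernels, NO rest inside the term) give the PURE rows -/

section PurePolynomial

open scoped BigOperators
open Literature.MathematicalPhysics.QuantumFieldTheory.Balaban1983to89.T3ContinuumYM3Torus
open Literature.MathematicalPhysics.QuantumFieldTheory.Balaban1983to89.T3LevelShift
open Literature.MathematicalPhysics.QuantumFieldTheory.Balaban1983to89.T3AlphaInputsAC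
open Literature.MathematicalPhysics.QuantumFieldTheory.Balaban1983to89.T3AlphaPolymerSocket
open Literature.MathematicalPhysics.QuantumFieldTheory.Balaban1983to89.T3AlphaInputsACTwoRun
open Literature.MathematicalPhysics.QuantumFieldTheory.Balaban1983to89.T3AlphaInputsACTwoRunLevel

/-- **PURE TAYLOR CORE (orders 2..6, NO remainders)** — sketch g9's `taylor_core` with `R₀ = R₁ = 0` and the bound kept slack-free:
`|Σ_{p=2}^{6}(Σ_{c′} E′ΠB′ − Σ_c EΠB)| ≤ 5·(C_s²C + 6C_sC_BC_E)·e·θ²·x⁴·ρ`, from `per_order`. [cite: King1986, Prop. 3.6 (3.56)-(3.57) p.662] -/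
theorem taylor_core_pure {ι ι' : Type*} [Fintype ι] [Fintype ι'] (m : ι ≃ ι')
    (E : (p : ℕ) → (Fin p → ι) → ℝ) (E' : (p : ℕ) → (Fin p → ι') → ℝ) (B₀ : ι → ℝ) (B₁ : ι' → ℝ) (r : ι → ℝ)
    {θ x ρ e C C_E C_s C_B : ℝ}
    (hθ : 0 ≤ θ) (hsθ : C_s * θ ≤ 1) (hx0 : 0 ≤ x) (hx1 : x ≤ 1) (hρ : 0 ≤ ρ) (hCs : 0 ≤ C_s) (hCB : 0 ≤ C_B) (hr : ∀ c, 0 ≤ r c)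
    (hB₀ : ∀ c, |B₀ c| ≤ C_s * θ * x ^ 2 * r c) (hB₁ : ∀ c, |B₁ (m c)| ≤ C_s * θ * x ^ 2 * r c)
    (hΔ : ∀ c, |B₁ (m c) - B₀ c| ≤ C_B * θ * x ^ 2 * ρ * r c)
    (hK : ∀ p ∈ Finset.Icc 2 6, ∑ c : Fin p → ι, |E' p (fun l => m (c l)) - E p c| * ∏ l, r (c l) ≤ C * e * ρ)
    (hE : ∀ p ∈ Finset.Icc 2 6, ∑ c : Fin p → ι, |E p c| * ∏ l, r (c l) ≤ C_E * e) :
    |(∑ p ∈ Finset.Icc 2 6, ∑ c' : Fin p → ι', E' p c' * ∏ l, B₁ (c' l)) -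
        (∑ p ∈ Finset.Icc 2 6, ∑ c : Fin p → ι, E p c * ∏ l, B₀ (c l))| ≤
      5 * (C_s ^ 2 * C + 6 * C_s * C_B * C_E) * e * θ ^ 2 * x ^ 4 * ρ := by
  have hx2 : x ^ 2 ≤ 1 := pow_le_one₀ hx0 hx1
  have hs0 : 0 ≤ C_s * θ * x ^ 2 := by positivity
  have hs1 : C_s * θ * x ^ 2 ≤ 1 := by
    calc C_s * θ * x ^ 2 ≤ 1 * 1 := mul_le_mul hsθ hx2 (by positivity) zero_le_one
      _ = 1 := one_mul 1
  have ht0 : 0 ≤ C_B * θ * x ^ 2 * ρ := by positivity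
  have hper : ∀ p ∈ Finset.Icc 2 6,
      |∑ c' : Fin p → ι', E' p c' * ∏ l, B₁ (c' l) - ∑ c : Fin p → ι, E p c * ∏ l, B₀ (c l)| ≤
        (C_s * θ * x ^ 2) ^ 2 * (C * e * ρ) + 6 * (C_s * θ * x ^ 2) * (C_B * θ * x ^ 2 * ρ) * (C_E * e) := by
    intro p hp
    have hp' := Finset.mem_Icc.mp hp
    exact per_order m hp'.1 hp'.2 (E p) (E' p) B₀ B₁ r hs0 hs1 ht0 hr hB₀ hB₁ hΔ (hK p hp) (hE p hp)
  rw [← Finset.sum_sub_distrib]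
  have hcard : (Finset.Icc 2 6).card = 5 := by rfl
  calc |∑ p ∈ Finset.Icc 2 6, (∑ c' : Fin p → ι', E' p c' * ∏ l, B₁ (c' l) - ∑ c : Fin p → ι, E p c * ∏ l, B₀ (c l))|
      ≤ ∑ p ∈ Finset.Icc 2 6, |∑ c' : Fin p → ι', E' p c' * ∏ l, B₁ (c' l) - ∑ c : Fin p → ι, E p c * ∏ l, B₀ (c l)| :=
        Finset.abs_sum_le_sum_abs _ _
    _ ≤ ∑ p ∈ Finset.Icc 2 6,
          ((C_s * θ * x ^ 2) ^ 2 * (C * e * ρ) + 6 * (C_s * θ * x ^ 2) * (C_B * θ * x ^ 2 * ρ) * (C_E * e)) :=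
        Finset.sum_le_sum hper
    _ = 5 * (C_s ^ 2 * C + 6 * C_s * C_B * C_E) * e * θ ^ 2 * x ^ 4 * ρ := by
        rw [Finset.sum_const, hcard, nsmul_eq_mul]; push_cast; ring

variable {F : T3Family} {γ : ℝ}

/-- **STRUCTURE ROW, PRINT'S FORM (43) EXACTLY** (hypothesis schema, never asserted; = sketch g9's `TaylorSplit PT E B 0`): the term = Σ_{p=2}^{6} Σ_c
flat kernel × loop-variable monomial, with NO rest inside the term — «polynomials in B of at least the second order, and at most the sixth order», every
higher order booked into the V-independent error of (41)/(47). [cite: Balaban1985UV3, (33)-(34) p.264, (43) p.266] -/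
def PolySplit (PT : TermFn F) (E : Kernel F) (B : CfgMapR F) : Prop :=
  ∀ (K k i : ℕ) (Y : Set (Site (F.P K) 0)) (W : GaugeField (F.P K) k (Matrix.specialUnitaryGroup (Fin 2) ℂ)),
    PT K k i Y W = ∑ p ∈ Finset.Icc 2 6, ∑ c : Fin p → PBond (F.P K) i, E K i Y p c * ∏ l, B K k i Y W (c l)

/-- **PRINT'S POLYNOMIAL ACTIVITIES GIVE THE PURE PER-POLYMER ROW.**  If the term function has print's form (43) p.266 EXACTLY — `PolySplit PT E B`:
`Σ_{p=2}^{6}` flat kernel × loop-variable monomial and NO order-≥7 rest inside the term ([Balaban1985UV3] books every higher (g,B)-order into the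
V-independent two-sided error of (41)/(47), the record's `Rm`) — then flat-kernel Cauchy (K1a) + kernel size + configuration size + configuration Cauchy
give the SLACK-FREE per-polymer row `PolymerCauchyMinAtT` with constant `5·(C_s²C + 6C_sC_BC_E)` and shifts `0`: no all-order input, no `θ(n)^σ`.
(Hypothesis schemas of sketch g9, never asserted; the theorem is algebra.) [cite: Balaban1985UV3, (33)-(34) p.264, (43)-(44) pp.266-267; King1986, Prop. 3.6 p.662] -/
theorem polymerCauchyMinAtT_of_polySplit {D : AlphaDataT3 F γ} {PT : TermFn F} {E : Kernel F} {B : CfgMapR F} {r : Radius F}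
    {b₀ p₀ κ a C C_E C_s C_B : ℝ}
    (hCs : 0 ≤ C_s) (hCB : 0 ≤ C_B) (hL : 1 ≤ (F.L : ℝ))
    (hθ0 : ∀ n, 0 ≤ θBal F.L γ b₀ p₀ n) (hθ1 : ∀ n, (C_s + C_B) * θBal F.L γ b₀ p₀ n ≤ 1) (hr : ∀ K i Y c, 0 ≤ r K i Y c)
    (hT : PolySplit PT E B) (hK : FlatKernelCauchy D E r κ a C) (hE : KernelSize D E r κ C_E)
    (hS : CfgSize D B r b₀ p₀ C_s) (hBC : CfgCauchy D B r b₀ p₀ a C_B) :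
    PolymerCauchyMinAtT D PT b₀ p₀ κ a (5 * (C_s ^ 2 * C + 6 * C_s * C_B * C_E)) := by
  refine ⟨fun _ _ _ _ => 0, ?_⟩
  intro K n hn j hj V hV Y hY
  have hSz := hS K n hn j hj V hV Y hY
  have hCy := hBC K n hn j hj V hV Y hY
  have hKc := hK K (K - n) (1 + j) Y hY
  have hEs := hE K (K - n) (1 + j) Y hY
  rw [sub_zero, hT, hT]
  have hsθ : C_s * θBal F.L γ b₀ p₀ n ≤ 1 := by nlinarith [hθ1 n, hθ0 n]
  have hx0 : 0 ≤ ((F.L : ℝ) ^ (K - n - 1 - j))⁻¹ := by positivity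
  have hx1 : ((F.L : ℝ) ^ (K - n - 1 - j))⁻¹ ≤ 1 := inv_le_one_of_one_le₀ (one_le_pow₀ hL)
  have hρ : 0 ≤ (((F.L : ℝ) ^ (1 + j))⁻¹) ^ a := Real.rpow_nonneg (by positivity) _
  exact taylor_core_pure (matchBond F K (1 + j)) (fun p c => E K (1 + j) Y p c)
    (fun p c' => E (K + 1) (1 + (j + 1)) (refineSet F K Y) p c') _ _ (r K (1 + j) Y) (hθ0 n) hsθ hx0 hx1 hρ hCs hCB
    (hr K (1 + j) Y) (fun c => (hSz c).1) (fun c => (hSz c).2) hCy hKc hEs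

/-- **NO REMAINDER ROW, EVERY `σ`.**  With print's polynomial activities (`PolySplit`) the per-polymer slack row of sketch g9 — the producer-side
currency of STUB 3⁗ (sketch g11's `globalSupRateTSlack_of_polymerSlack` turns it into `GlobalSlack.GlobalSupRateTSlack` by counting) — holds for EVERY slack
exponent `σ : ℕ` from K1a + sizes + configuration Cauchy alone: `RemainderSmall`/K1c is not among the hypotheses and no truncation order enters.
[cite: Balaban1985UV3, (43)-(44) pp.266-267; King1986, Thm 3.4 (3.9) p.656] -/
theorem polymerCauchyMinAtTSlack_of_polySplit {D : AlphaDataT3 F γ} {PT : TermFn F} {E : Kernel F} {B : CfgMapR F} {r : Radius F}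
    {b₀ p₀ κ a C C_E C_s C_B : ℝ} (σ : ℕ)
    (hC : 0 ≤ C) (hCE : 0 ≤ C_E) (hCs : 0 ≤ C_s) (hCB : 0 ≤ C_B) (hL : 1 ≤ (F.L : ℝ))
    (hθ0 : ∀ n, 0 ≤ θBal F.L γ b₀ p₀ n) (hθ1 : ∀ n, (C_s + C_B) * θBal F.L γ b₀ p₀ n ≤ 1) (hr : ∀ K i Y c, 0 ≤ r K i Y c)
    (hT : PolySplit PT E B) (hK : FlatKernelCauchy D E r κ a C) (hE : KernelSize D E r κ C_E)
    (hS : CfgSize D B r b₀ p₀ C_s) (hBC : CfgCauchy D B r b₀ p₀ a C_B) :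
    PolymerCauchyMinAtTSlack D PT b₀ p₀ κ a σ (5 * (C_s ^ 2 * C + 6 * C_s * C_B * C_E)) := by
  have h5 : 0 ≤ 5 * (C_s ^ 2 * C + 6 * C_s * C_B * C_E) := by positivity
  exact slack_of_pure σ h5 hθ0 (polymerCauchyMinAtT_of_polySplit hCs hCB hL hθ0 hθ1 hr hT hK hE hS hBC)

end PurePolynomial

end Summit.QuantumFields.YangMills.Cruxes.FluctuationComparisonRegPr.Ideate2SlackOrder

end
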